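import Mathlib
import HarnessLib
import Summits.CriticalPhenomena.SAWScalingLimit.Theorems.SAWSpinMonotoneQCIdentificationDefs
import Summits.CriticalPhenomena.SAWScalingLimit.Theorems.SAWSpinMonotoneQCIdentificationNoBranchingAlgebra
import Summits.CriticalPhenomena.SAWScalingLimit.Theorems.SAWSpinMonotoneQCIdentificationAffineDictionary

/-!
# Discrete Stokes on the face complex of a hexagonal domain (helper, line `eight_fifths_primitive`)

Helper sub-goal (wave 3) of the stubs `stub_rayCondition` (Smirnov's primitive `Φ_δ = ∫ F^{8/5} dz`
needs a discrete Stokes theorem on the face complex `K_Λ = ⋃_{v ∈ Λ} Δ_v`) and `stub_noBranching`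
(S7 assembly) of line `eight_fifths_primitive`, crux `QCIdentification` (stmt-CriticalPhenomena-16772);
namespace of the checked skeleton, sub-namespace `Stokes`; vocabulary from
`SAWSpinMonotoneQCIdentificationDefs` (`hexNbr v k`, the three counterclockwise neighbours of a
hexagonal-lattice vertex), `…NoBranchingAlgebra` (`NB.adj_hexNbr`, `NB.hexNbr_ne`) and
`…AffineDictionary` (`Dev.triVert v k`, the counterclockwise corners of the triangle `Δ_v`, the
`𝕋`-edge `[triVert v k, triVert v (k+1)]` being the one crossed by the port `{v, hexNbr v k}`).

**What.** A *port function* `d : HexVertex → Fin 3 → M` attaches a value to each of the three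
ports (darts) `(v, k)`, `k : Fin 3`, of every vertex `v`.

* (the port involution) the port labels are parallel classes: port `k` of the far endpoint of port
  `k` points back, `hexNbr (hexNbr v k) k = v` (`hexNbr_hexNbr`; registered `st_exists_back`: the
  back port exists and is unique), and the `𝕋`-edge crossed by the port is traversed in OPPOSITE
  directions by the two triangles: `triVert (hexNbr v k) k = triVert v (k+1)`,
  `triVert (hexNbr v k) (k+1) = triVert v k` (`triVert_hexNbr`, `triVert_hexNbr_succ`);
* (regrouping by the far endpoint) the interior ports of `Λ` (both endpoints in `Λ`) are permuted
  by the involution `(v, k) ↦ (hexNbr v k, k)`, so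
  `Σ_{v ∈ Λ} Σ_k [hexNbr v k ∈ Λ] d v k = Σ_{v ∈ Λ} Σ_k [hexNbr v k ∈ Λ] d (hexNbr v k) k`
  (`sum_interior_ports_swap`);
* (regrouping by the boundary mid-edge) the boundary ports of `Λ` (far endpoint outside `Λ`) are in
  bijection with the boundary mid-edges `hexDomainBoundary Λ` (`coe_image_boundaryPorts`), so a
  boundary term depending only on the mid-edge is a `finsum` over `hexDomainBoundary Λ`
  (`sum_boundary_ports_eq_finsum`; companion of `Bulk.bulk_finsum_midEdges_eq`);
* (**discrete Stokes**, registered `st_sum_ports_eq_sum_boundary_ports`) if `d` is ANTISYMMETRIC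
  across interior mid-edges, `d v k + d (hexNbr v k) k = 0` whenever `v, hexNbr v k ∈ Λ`, then the
  interior ports cancel in pairs (`Finset.sum_involution`, no division by `2`, any additive
  commutative monoid `M`) and the total over all ports of `Λ` equals the total over the BOUNDARY
  ports (far endpoint outside `Λ`):
  `Σ_{v ∈ Λ} Σ_k d v k = Σ_{v ∈ Λ} Σ_k [hexNbr v k ∉ Λ] d v k`;
* (registered `st_sum_oneForm_eq_boundary`) in particular for a discrete 1-form `α` on oriented
  `𝕋`-edges (`α x y + α y x = 0`) the sum over `v ∈ Λ` of the circulations `∮_{∂Δ_v} α` equals the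
  circulation along the boundary edges of `K_Λ`: `Σ_v ∮_{∂Δ_v} α = ∮_{∂K_Λ} α`.

Sources: folklore (double counting of darts; the combinatorial Stokes theorem on a 2-complex);
S. Smirnov, *Towards conformal invariance of 2D lattice models*, Proc. ICM 2006, §5.6 (the primitive
`∫ F^{1/σ}` summed triangle by triangle); H. Duminil-Copin, S. Smirnov, Ann. of Math. 175 (2012)
1653–1665, Remark 1 (vertex relation = discrete contour integral around `Δ_v`).
-/

open scoped BigOperators
open Literature.Probability.LatticeModels Literature.Probability.RandomPlanarGeometry
open Literature.Probability.RandomPlanarGeometry.SAW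
open Literature.Barriers.CriticalPhenomena

namespace Summit.CriticalPhenomena.SAWScalingLimit.Cruxes.QCIdentification.EightFifthsPrimitive

namespace Stokes

/-! ## The port involution -/

/-- **Port `k` of the far endpoint of port `k` points back**: `hexNbr (hexNbr v k) k = v`. -/
theorem hexNbr_hexNbr (v : HexVertex) (k : Fin 3) : hexNbr (hexNbr v k) k = v := by
  obtain ⟨x, t⟩ := v
  fin_cases t <;> fin_cases k <;> simp [hexNbr]

/-- A port never points back to its own vertex (the honeycomb lattice is bipartite). -/
theorem hexNbr_ne_self (v : HexVertex) (k : Fin 3) : hexNbr v k ≠ v :=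
  (NB.adj_hexNbr v k).ne'

/-- **The back port (registered form).** For every port `(v, k)` there is exactly one port of the far
endpoint `hexNbr v k` pointing back to `v` — namely port `k` itself (`hexNbr_hexNbr`). -/
theorem st_exists_back : ∀ (v : HexVertex) (k : Fin 3), ∃! k' : Fin 3, hexNbr (hexNbr v k) k' = v := by
  intro v k
  refine ⟨k, hexNbr_hexNbr v k, fun k' hk' => ?_⟩
  by_contra hne
  exact NB.hexNbr_ne (hexNbr v k) hne (hk'.trans (hexNbr_hexNbr v k).symm)

/-- Seen from the far endpoint, the `𝕋`-edge crossed by port `k` starts where it ends in `Δ_v`: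
`triVert (hexNbr v k) k = triVert v (k + 1)`. -/
theorem triVert_hexNbr (v : HexVertex) (k : Fin 3) :
    Dev.triVert (hexNbr v k) k = Dev.triVert v (k + 1) := by
  obtain ⟨x, t⟩ := v
  fin_cases t <;> fin_cases k <;>
    simp [hexNbr, Dev.triVert, funext_iff, Fin.forall_fin_two, Pi.single_apply]

/-- Seen from the far endpoint, the `𝕋`-edge crossed by port `k` ends where it starts in `Δ_v`:
`triVert (hexNbr v k) (k + 1) = triVert v k` (the shared edge is traversed in opposite directions). -/
theorem triVert_hexNbr_succ (v : HexVertex) (k : Fin 3) :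
    Dev.triVert (hexNbr v k) (k + 1) = Dev.triVert v k := by
  obtain ⟨x, t⟩ := v
  fin_cases t <;> fin_cases k <;>
    simp [hexNbr, Dev.triVert, funext_iff, Fin.forall_fin_two, Pi.single_apply]

/-! ## Interior ports: regrouping by the far endpoint

The interior ports of `Λ` (both endpoints in `Λ`) form the finite set of darts
`{x ∈ Λ ×ˢ univ | hexNbr x.1 x.2 ∈ Λ}`; the boundary ports (far endpoint outside `Λ`) the set
`{x ∈ Λ ×ˢ univ | hexNbr x.1 x.2 ∉ Λ}`. -/

/-- The involution `(v, k) ↦ (hexNbr v k, k)` preserves the interior ports. -/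
theorem swap_mem_interiorPorts {Λ : Finset HexVertex} {x : HexVertex × Fin 3}
    (hx : x ∈ (Λ ×ˢ (Finset.univ : Finset (Fin 3))).filter fun x => hexNbr x.1 x.2 ∈ Λ) :
    (hexNbr x.1 x.2, x.2) ∈ (Λ ×ˢ (Finset.univ : Finset (Fin 3))).filter fun x => hexNbr x.1 x.2 ∈ Λ := by
  simp only [Finset.mem_filter, Finset.mem_product, Finset.mem_univ, and_true] at hx ⊢
  exact ⟨hx.2, by rw [hexNbr_hexNbr]; exact hx.1⟩

/-- A vertex-by-vertex sum restricted to interior ports is a sum over the interior darts. -/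
theorem sum_ite_interior_eq {M : Type*} [AddCommMonoid M] (Λ : Finset HexVertex)
    (g : HexVertex × Fin 3 → M) :
    ∑ v ∈ Λ, ∑ k : Fin 3, (if hexNbr v k ∈ Λ then g (v, k) else 0) =
      ∑ x ∈ (Λ ×ˢ (Finset.univ : Finset (Fin 3))).filter (fun x => hexNbr x.1 x.2 ∈ Λ), g x := by
  rw [Finset.sum_filter, Finset.sum_product]

/-- **Regrouping by the far endpoint.** Over the interior ports of `Λ`, summing `d` at the port or at
its back port gives the same total (the involution `(v, k) ↦ (hexNbr v k, k)` permutes them). -/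
theorem sum_interior_ports_swap {M : Type*} [AddCommMonoid M] (Λ : Finset HexVertex)
    (d : HexVertex → Fin 3 → M) :
    ∑ v ∈ Λ, ∑ k : Fin 3, (if hexNbr v k ∈ Λ then d v k else 0) =
      ∑ v ∈ Λ, ∑ k : Fin 3, (if hexNbr v k ∈ Λ then d (hexNbr v k) k else 0) := by
  have h1 := sum_ite_interior_eq Λ fun x => d x.1 x.2
  have h2 := sum_ite_interior_eq Λ fun x => d (hexNbr x.1 x.2) x.2
  simp only at h1 h2
  rw [h1, h2]
  symm
  refine Finset.sum_nbij' (fun x => (hexNbr x.1 x.2, x.2)) (fun x => (hexNbr x.1 x.2, x.2))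
    (fun x hx => swap_mem_interiorPorts hx) (fun x hx => swap_mem_interiorPorts hx)
    (fun x _ => ?_) (fun x _ => ?_) (fun x _ => rfl)
  · simp only [hexNbr_hexNbr]
  · simp only [hexNbr_hexNbr]

/-- **Interior ports of an antisymmetric port function cancel in pairs.** -/
theorem sum_interior_ports_eq_zero {M : Type*} [AddCommMonoid M] (Λ : Finset HexVertex)
    (d : HexVertex → Fin 3 → M)
    (hd : ∀ v ∈ Λ, ∀ k : Fin 3, hexNbr v k ∈ Λ → d v k + d (hexNbr v k) k = 0) :
    ∑ v ∈ Λ, ∑ k : Fin 3, (if hexNbr v k ∈ Λ then d v k else 0) = 0 := by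
  have h1 := sum_ite_interior_eq Λ fun x => d x.1 x.2
  simp only at h1
  rw [h1]
  refine Finset.sum_involution (fun x _ => (hexNbr x.1 x.2, x.2)) (fun x hx => ?_)
    (fun x _ _ h => hexNbr_ne_self x.1 x.2 (congrArg Prod.fst h))
    (fun x hx => swap_mem_interiorPorts hx) (fun x _ => ?_)
  · simp only [Finset.mem_filter, Finset.mem_product, Finset.mem_univ, and_true] at hx
    exact hd x.1 hx.1 x.2 hx.2
  · simp only [hexNbr_hexNbr]

/-! ## Boundary ports: regrouping by the boundary mid-edge -/

/-- A vertex-by-vertex sum restricted to boundary ports is a sum over the boundary darts. -/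
theorem sum_ite_boundary_eq {M : Type*} [AddCommMonoid M] (Λ : Finset HexVertex)
    (g : HexVertex × Fin 3 → M) :
    ∑ v ∈ Λ, ∑ k : Fin 3, (if hexNbr v k ∈ Λ then 0 else g (v, k)) =
      ∑ x ∈ (Λ ×ˢ (Finset.univ : Finset (Fin 3))).filter (fun x => hexNbr x.1 x.2 ∉ Λ), g x := by
  rw [Finset.sum_filter, Finset.sum_product]
  simp only [ite_not]

/-- The mid-edge of a boundary port determines the port. -/
theorem mk_injOn_boundaryPorts (Λ : Finset HexVertex) :
    Set.InjOn (fun x : HexVertex × Fin 3 => s(x.1, hexNbr x.1 x.2))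
      ((Λ ×ˢ (Finset.univ : Finset (Fin 3))).filter fun x => hexNbr x.1 x.2 ∉ Λ) := by
  rintro ⟨v, k⟩ hx ⟨v', k'⟩ hx' h
  simp only [Finset.coe_filter, Finset.mem_product, Finset.mem_univ, and_true,
    Set.mem_setOf_eq] at hx hx'
  rcases Sym2.eq_iff.1 h with ⟨rfl, h2⟩ | ⟨rfl, -⟩
  · simp only [Prod.mk.injEq, true_and]
    by_contra hne
    exact NB.hexNbr_ne v hne h2
  · exact absurd hx.1 hx'.2

/-- The mid-edges of the boundary ports are exactly the boundary mid-edges `hexDomainBoundary Λ`. -/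
theorem coe_image_boundaryPorts (Λ : Finset HexVertex) :
    ((((Λ ×ˢ (Finset.univ : Finset (Fin 3))).filter fun x => hexNbr x.1 x.2 ∉ Λ).image
        fun x => s(x.1, hexNbr x.1 x.2) : Finset (Sym2 HexVertex)) : Set (Sym2 HexVertex)) =
      hexDomainBoundary Λ := by
  ext e
  rw [Finset.mem_coe]
  constructor
  · intro h
    obtain ⟨⟨v, k⟩, hx, rfl⟩ := Finset.mem_image.1 h
    simp only [Finset.mem_filter, Finset.mem_product, Finset.mem_univ, and_true] at hx
    exact ⟨(SimpleGraph.mem_edgeSet hexGraph).2 (NB.adj_hexNbr v k), hexNbr v k, v, Sym2.eq_swap,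
      hx.1, hx.2⟩
  · rintro ⟨he, u, v, rfl, hv, hu⟩
    obtain ⟨k, rfl⟩ := NB.exists_hexNbr_eq ((SimpleGraph.mem_edgeSet hexGraph).1 he).symm
    refine Finset.mem_image.2 ⟨(v, k), ?_, Sym2.eq_swap⟩
    simp only [Finset.mem_filter, Finset.mem_product, Finset.mem_univ, and_true]
    exact ⟨hv, hu⟩

/-- **Regrouping the boundary ports by boundary mid-edge.** A boundary term depending only on the
mid-edge of the port is the `finsum` over the boundary mid-edges `hexDomainBoundary Λ` (each boundary
mid-edge is the mid-edge of exactly one boundary port). -/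
theorem sum_boundary_ports_eq_finsum {M : Type*} [AddCommMonoid M] (Λ : Finset HexVertex)
    (g : Sym2 HexVertex → M) :
    ∑ v ∈ Λ, ∑ k : Fin 3, (if hexNbr v k ∈ Λ then 0 else g s(v, hexNbr v k)) =
      ∑ᶠ e ∈ hexDomainBoundary Λ, g e := by
  have h1 := sum_ite_boundary_eq Λ fun x => g s(x.1, hexNbr x.1 x.2)
  simp only at h1
  rw [h1, ← coe_image_boundaryPorts, finsum_mem_coe_finset,
    Finset.sum_image (mk_injOn_boundaryPorts Λ)]

/-! ## Discrete Stokes -/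

/-- **Discrete Stokes theorem on a hexagonal domain (registered form).** For a port function that
is antisymmetric across interior mid-edges, the total over all ports of all vertices of `Λ` equals
the total over the boundary ports (far endpoint outside `Λ`) only. -/
theorem st_sum_ports_eq_sum_boundary_ports : ∀ {M : Type*} [AddCommMonoid M] (Λ : Finset HexVertex) (d : HexVertex → Fin 3 → M), (∀ v ∈ Λ, ∀ k : Fin 3, hexNbr v k ∈ Λ → d v k + d (hexNbr v k) k = 0) → ∑ v ∈ Λ, ∑ k : Fin 3, d v k = ∑ v ∈ Λ, ∑ k : Fin 3, (if hexNbr v k ∈ Λ then 0 else d v k) := by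
  intro M _ Λ d hd
  have hsplit : ∀ v : HexVertex, ∀ k : Fin 3, d v k =
      (if hexNbr v k ∈ Λ then d v k else 0) + (if hexNbr v k ∈ Λ then 0 else d v k) := by
    intro v k
    split_ifs <;> simp
  calc ∑ v ∈ Λ, ∑ k : Fin 3, d v k
      = ∑ v ∈ Λ, ∑ k : Fin 3,
          ((if hexNbr v k ∈ Λ then d v k else 0) + (if hexNbr v k ∈ Λ then 0 else d v k)) :=
        Finset.sum_congr rfl fun v _ => Finset.sum_congr rfl fun k _ => hsplit v k
    _ = ∑ v ∈ Λ, ∑ k : Fin 3, (if hexNbr v k ∈ Λ then d v k else 0) +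
          ∑ v ∈ Λ, ∑ k : Fin 3, (if hexNbr v k ∈ Λ then 0 else d v k) := by
        simp_rw [Finset.sum_add_distrib]
    _ = ∑ v ∈ Λ, ∑ k : Fin 3, (if hexNbr v k ∈ Λ then 0 else d v k) := by
        rw [sum_interior_ports_eq_zero Λ d hd, zero_add]

/-- **Discrete Stokes for 1-forms on the face complex `K_Λ` (registered form).** For an antisymmetric
function `α` on ordered pairs of sites (a discrete 1-form on oriented `𝕋`-edges), the sum over the
faces `v ∈ Λ` of the counterclockwise circulations `Σ_k α (triVert v k) (triVert v (k+1))` equals the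
circulation along the boundary edges only (those crossed by a port leaving `Λ`): every interior
`𝕋`-edge is traversed once in each direction. -/
theorem st_sum_oneForm_eq_boundary : ∀ {M : Type*} [AddCommMonoid M] (Λ : Finset HexVertex) (α : Site 2 → Site 2 → M), (∀ x y : Site 2, α x y + α y x = 0) → ∑ v ∈ Λ, ∑ k : Fin 3, α (Dev.triVert v k) (Dev.triVert v (k + 1)) = ∑ v ∈ Λ, ∑ k : Fin 3, (if hexNbr v k ∈ Λ then 0 else α (Dev.triVert v k) (Dev.triVert v (k + 1))) := by
  intro M _ Λ α hα
  refine st_sum_ports_eq_sum_boundary_ports Λ (fun v k => α (Dev.triVert v k) (Dev.triVert v (k + 1)))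
    fun v _ k _ => ?_
  simp only [triVert_hexNbr, triVert_hexNbr_succ]
  exact hα _ _

end Stokes

end Summit.CriticalPhenomena.SAWScalingLimit.Cruxes.QCIdentification.EightFifthsPrimitive
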